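import Literature.AlgebraicGeometry.ShimuraVarieties.UnitaryCurveAuxiliaryHeckeNeighbourIndex
import Literature.AlgebraicGeometry.ShimuraVarieties.UnitaryCurveAuxiliaryHeckeNeighbourCounts
import Literature.AlgebraicGeometry.ShimuraVarieties.UnitaryCurveAuxiliaryHeckeTransporter
import Literature.NumberTheory.Automorphic.UnitaryGroupHeckeDegreeSplitPlace
import Literature.NumberTheory.Automorphic.GaloisActionPlaces
import HarnessLib

/-!
# The Hecke LINE LATTICES of a marked fibre in READING currency: the `q + 1` lattices `H_β = 𝔭_w⁻¹·T_β⁻¹Λ(r₂^β) ⊓ 𝔭_{c•w}⁻¹Λ(r₁)` moved from the frame by the class mover `q₁`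

Topic `AlgebraicGeometry/ShimuraVarieties`; namespace `Literature.AlgebraicGeometry.ShimuraVarieties.UnitaryCurve.AuxV`.  THEOREMS ONLY (no definition,
no named fact, no instance, no notation, no `sorry`).  Cell `hodgecm-mathlib` (D-0151), FLOOR 0, P6 «MOD programme» (crux hLiu418 = stmt-HodgeConjecture-24832,
`--supports`, count-neutral), EHECKE closer leaf organ **(O-R1) «lines and `t₁`-roofs at complex points»** (LA5-plan (g3) skeleton v5∕v6 `OrganER1`), the LATTICE
INPUTS of conjuncts (1)–(3) of `HeckeLinesRoofsAt` (★ `SiegelAdelicMarking.exists_stableLines`: `hΛ h𝔞 hinj hcard hst hexh`) and the READER of conjunct (4)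
(★ `exists_heckeLineRoof_of_markedReadings`: `hL`), transported from the FRAME currency of ★ `UnitaryCurveAuxiliaryHeckeNeighbourIndex` ∕ ★
`UnitaryCurveAuxiliaryHeckeNeighbourCounts` (LA5-p02 (g3), (L-c)(L-c′)) to the READING of the marked fibre by the FIXED class mover `q₁` of (O-MP) STAGE A;
HC_CM is proved only modulo the printed citations until rung 0 closes.

SETTING ([ShimuraIATAF1971] §3.2 Lemma 3.22–3.23, §7.3; [Milne2005ShimuraVarieties] §6 Thm. 6.11 p. 74 and p. 75; [Kottwitz1992] §5 p. 390).  `Fr` the E1 symplectic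
frame with twist datum `(γ, T, T′)` and integral `𝓞_F`-reading `ρ` (`hρ`); `K` a level hyperspecial at the split place `w` (`J⋆_w ∈ GL₂(𝒪_w)`); `a′` the frame
representative of the complex point, `r₁` the adelic representative of its READING with class mover `q₁` (`q₁ • r₁ ≡ ũ(a′, 1) (mod K_δ(N))`, so
`Λ(r₁) = q₁⁻¹Λ_{ũ(a′,1)}`) and reading `M₁ = q₁⁻¹ ρ q₁`; `rc β` representatives of the cosets `β ∈ K t_{w,1} K ∕ K`.  THE LINE LATTICES are
`H_β := q₁⁻¹ · (𝔭_w⁻¹Λ_{ũ(a′·rc β,1)} ⊓ 𝔭_{c•w}⁻¹Λ_{ũ(a′,1)})` (★ (L-c) frame neighbour lattice moved by `q₁`; `c⁻¹ = c`).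

* §0 plumbing: the place idempotent `ε_{u₀}` exists; relative indices and readers along the `ℚ`-linear automorphism `v ↦ q v`.
* §1 **`exists_heckeLineLattices`** — the family `H_β` with: `Λ(r₁) ≤ H_β`; `M₁(𝔭_{c•w}) H_β ⊆ Λ(r₁)`; `β ↦ H_β` injective (★ `mk_eq_mk_of_heckeNeighbour_auxToGspFinV_eq`);
  `[H_β : Λ(r₁)] = #(𝓞_F ∕ 𝔭_{c•w})` (★ (L-c)); `M₁`-stable; EXHAUSTIVE among the `M₁`-stable lattices of that index between `Λ(r₁)` and `𝔭_{c•w}⁻¹Λ(r₁)` (★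
  `exists_eq_of_injective_heckeNeighbour_auxToGspFinV` with `#(K t_{w,1} K ∕ K) = q + 1` ★ `natCard_orbit_heckeElementAt_one_uniformizer`); and, for every β and
  every READING `(r₂, q₂)` of the translate (`q₂ • r₂ ≡ ũ(a′·rc β, 1)`), THE READER `v ∈ H_β ↔ (∀ π ∈ 𝔭_w, (q₂⁻¹q₁ · M₁ π) v ∈ Λ(r₂)) ∧ (∀ a ∈ 𝔭_{c•w}, M₁ a v ∈ Λ(r₁))`
  — the `hL` of ★ `exists_heckeLineRoof_of_markedReadings` at the transporter `T_β = q₂⁻¹q₁` of (O-MP) STAGE B.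

References: [ShimuraIATAF1971] G. Shimura, *Introduction to the Arithmetic Theory of Automorphic Functions* (1971), §3.2, §7.3; [Milne2005ShimuraVarieties] J. S.
Milne, *Introduction to Shimura varieties* (2005), §4 pp. 48–49, §6 Thm. 6.11 p. 74 and p. 75; [Kottwitz1992] R. Kottwitz, JAMS 5 (1992), §5 p. 390;
[DiamondShurman2005] F. Diamond, J. Shurman, *A First Course in Modular Forms* (2005), §5.2.

#harness_tags number_theory.shimura_varieties, number_theory.adeles, linear_algebra.lattices
-/

set_option autoImplicit false

noncomputable section

open Matrix NumberField IsDedekindDomain MulAction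
open scoped Pointwise
open Literature.AlgebraicGeometry.ModuliOfAbelianVarieties
open Literature.NumberTheory.Automorphic (integralFiniteAdeles glInt)
open Literature.NumberTheory.Adeles (latticeOfGL mem_latticeOfGL_iff)

namespace Literature.AlgebraicGeometry.ShimuraVarieties

namespace UnitaryCurve

namespace AuxV

open Literature.AlgebraicGeometry.ShimuraVarieties.UnitaryCanonicalModel.Aux (ratBasis torusFinAdelic)
open Literature.NumberTheory.Automorphic Literature.NumberTheory.Automorphic.UnitaryGroup

variable {F : Type} [Field F] [NumberField F] [IsCMField F] {Jstar : Matrix (Fin 2) (Fin 2) F} {ξ : F} {g : ℕ} {δ : Fin g → ℕ}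

/-! ### §0 Plumbing -/

omit [IsCMField F] in
/-- **The place idempotent**: a finite adele `ε` of `F` with `ε_{u₀} = 1` and `ε_u = 0` for `u ≠ u₀`. [folklore] -/
private theorem exists_placeIdempotent (u₀ : HeightOneSpectrum (𝓞 F)) :
    ∃ ε : FiniteAdeleRing (𝓞 F) F, ε u₀ = 1 ∧ ∀ u, u ≠ u₀ → ε u = 0 := by
  classical
  refine ⟨⟨fun u => if u = u₀ then 1 else 0, Filter.Eventually.of_forall fun u => ?_⟩, ?_, fun u hu => ?_⟩
  · change (if u = u₀ then (1 : u.adicCompletion F) else 0) ∈ u.adicCompletionIntegers F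
    split_ifs
    · exact one_mem _
    · exact zero_mem _
  · change (if u₀ = u₀ then (1 : u₀.adicCompletion F) else 0) = 1
    rw [if_pos rfl]
  · change (if u = u₀ then (1 : u.adicCompletion F) else 0) = 0
    rw [if_neg hu]

/-- The relative index of two `ℤ`-submodules of `ℚⁿ` is unchanged by pulling both back along a SURJECTIVE `ℤ`-linear map. [folklore] -/
private theorem relIndex_comap_comap_of_surjective {V W : Type*} [AddCommGroup V] [AddCommGroup W] [Module ℤ V] [Module ℤ W]
    (f : V →ₗ[ℤ] W) (hf : Function.Surjective f) (A B : Submodule ℤ W) :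
    (A.comap f).toAddSubgroup.relIndex (B.comap f).toAddSubgroup = A.toAddSubgroup.relIndex B.toAddSubgroup := by
  have hA : (A.comap f).toAddSubgroup = A.toAddSubgroup.comap f.toAddMonoidHom := rfl
  have hB : (B.comap f).toAddSubgroup = B.toAddSubgroup.comap f.toAddMonoidHom := rfl
  rw [hA, hB, AddSubgroup.relIndex_comap, AddSubgroup.map_comap_eq_self_of_surjective]
  exact hf

/-- `v ↦ q v` is surjective on `ℚⁿ` for `q ∈ GL_n(ℚ)`. [folklore] -/
private theorem mulVecLin_surjective_of_GL {n : Type} [Fintype n] [DecidableEq n] (q : GL n ℚ) :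
    Function.Surjective ((((q : GL n ℚ) : Matrix n n ℚ).mulVecLin).restrictScalars ℤ) := fun y =>
  ⟨((q⁻¹ : GL n ℚ) : Matrix n n ℚ) *ᵥ y, by
    rw [LinearMap.restrictScalars_apply, Matrix.mulVecLin_apply, Matrix.mulVec_mulVec, ← Units.val_mul, mul_inv_cancel, Units.val_one,
      Matrix.one_mulVec]⟩

/-- `v ↦ q v` is injective on `ℚⁿ` for `q ∈ GL_n(ℚ)`. [folklore] -/
private theorem mulVecLin_injective_of_GL {n : Type} [Fintype n] [DecidableEq n] (q : GL n ℚ) :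
    Function.Injective ((((q : GL n ℚ) : Matrix n n ℚ).mulVecLin).restrictScalars ℤ) := fun x y hxy => by
  have h := congrArg (fun z => ((q⁻¹ : GL n ℚ) : Matrix n n ℚ) *ᵥ z) hxy
  simpa only [LinearMap.restrictScalars_apply, Matrix.mulVecLin_apply, Matrix.mulVec_mulVec, ← Units.val_mul, inv_mul_cancel, Units.val_one,
    Matrix.one_mulVec] using h


/-! ### §1 The line lattices in reading currency -/

open Literature.NumberTheory.GaloisRepresentations in
set_option maxHeartbeats 400000 in
/-- **THE HECKE LINE LATTICES OF A MARKED FIBRE, READ THROUGH THE CLASS MOVER `q₁`.**  Frame `Fr` with twist datum `(γ, T, T′)` and integral reading `ρ`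
(`hρ`); level `K` hyperspecial at the split place `w` with `J⋆_w ∈ GL₂(𝒪_w)`; frame representative `a′`; a READING `(r₁, q₁, M₁)` of the fibre:
`q₁ • r₁ ≡ ũ(a′,1) (mod K_δ(N))` and `M₁ = q₁⁻¹ ρ q₁`; representatives `rc β` of `β ∈ K t_{w,1} K ∕ K`.  THEN there is a family of `ℤ`-lattices
`H_β ⊆ ℚ^{2g}` (`= q₁⁻¹·(𝔭_w⁻¹Λ_{ũ(a′·rc β,1)} ⊓ 𝔭_{c•w}⁻¹Λ_{ũ(a′,1)})`) such that: `Λ(r₁) ≤ H_β`; `M₁(𝔭_{c•w})H_β ⊆ Λ(r₁)`; `β ↦ H_β` is injective;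
`[H_β : Λ(r₁)] = #(𝓞_F ∕ 𝔭_{c•w})`; `H_β` is `M₁`-stable; every `M₁`-stable `L` with `Λ(r₁) ≤ L ⊆ 𝔭_{c•w}⁻¹Λ(r₁)` of that index is some `H_β` — the six lattice
inputs `hΛ h𝔞 hinj hcard hst hexh` of ★ `SiegelAdelicMarking.exists_stableLines` at `a := r₁`, `M := (M₁ ·)_ℚ`, `𝔞 := 𝔭_{c•w}` — and, for every READING
`(r₂, q₂)` of the translate (`q₂ • r₂ ≡ ũ(a′·rc β,1)`), the READER `v ∈ H_β ↔ (∀ π ∈ 𝔭_w, (q₂⁻¹q₁·M₁ π) v ∈ Λ(r₂)) ∧ (∀ a ∈ 𝔭_{c•w}, (M₁ a) v ∈ Λ(r₁))` —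
the `hL` of ★ `exists_heckeLineRoof_of_markedReadings` at the transporter `T_β = q₂⁻¹q₁`.  Everything is ★ (L-c) `UnitaryCurveAuxiliaryHeckeNeighbourIndex` ∕
★ `…Counts` in FRAME currency (with `#(K t_{w,1} K ∕ K) = q + 1`, ★ `natCard_orbit_heckeElementAt_one_uniformizer`, and `c⁻¹ = c`) moved along the
`ℚ`-linear automorphism `v ↦ q₁ v` (★ `latticeOfGL_eq_of_smul_mk_eq`, ★ `mem_latticeOfGL_inv_mul_iff`).
[cite: ShimuraIATAF1971, §3.2 Lemma 3.22–3.23, §7.3] [cite: Milne2005ShimuraVarieties, §6 Thm. 6.11 p. 74 and p. 75] [cite: Kottwitz1992, §5 p. 390]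
[cite: DiamondShurman2005, §5.2] -/
theorem exists_heckeLineLattices
    (Fr : SymplecticFrameV F (RingHom.id F) Jstar ξ g δ)
    (γ : GL (Fin 2 × Fin (Module.finrank ℚ F)) ℚ)
    (T : Matrix (Fin g ⊕ Fin g) (Fin 2 × Fin (Module.finrank ℚ F)) ℤ) (T' : Matrix (Fin 2 × Fin (Module.finrank ℚ F)) (Fin g ⊕ Fin g) ℤ)
    (hTT' : T * T' = 1) (hT'T : T' * T = 1)
    (hP : framePV Fr = T.map (Int.cast : ℤ → ℚ) * ((γ : GL (Fin 2 × Fin (Module.finrank ℚ F)) ℚ) : Matrix (Fin 2 × Fin (Module.finrank ℚ F)) (Fin 2 × Fin (Module.finrank ℚ F)) ℚ))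
    (hγS : ∀ b : 𝓞 F, ∀ i i', ∃ z : ℤ,
      (((γ : GL (Fin 2 × Fin (Module.finrank ℚ F)) ℚ) : Matrix (Fin 2 × Fin (Module.finrank ℚ F)) (Fin 2 × Fin (Module.finrank ℚ F)) ℚ) *
            resMatrix (m := Fin 2) (ratBasis F) (((b : 𝓞 F) : F) • (1 : Matrix (Fin 2) (Fin 2) F)) *
          ((γ⁻¹ : GL (Fin 2 × Fin (Module.finrank ℚ F)) ℚ) : Matrix (Fin 2 × Fin (Module.finrank ℚ F)) (Fin 2 × Fin (Module.finrank ℚ F)) ℚ)) i i' = (z : ℚ))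
    (ρ : 𝓞 F →+* Matrix (Fin g ⊕ Fin g) (Fin g ⊕ Fin g) ℤ)
    (hρ : ∀ b : 𝓞 F, (ρ b).map (Int.cast : ℤ → ℚ) =
      framePV Fr * resMatrix (m := Fin 2) (ratBasis F) (((b : 𝓞 F) : F) • (1 : Matrix (Fin 2) (Fin 2) F)) * frameQV Fr)
    (K : Subgroup ↥(finAdelic (↥(maximalRealSubfield F)) F (IsCMField.complexConj F) 2 Jstar))
    (hγ : ∀ p ∈ K.prod (⊥ : Subgroup ↥(torusFinAdelic F)),
      (∀ i i', ((Matrix.GeneralLinearGroup.map (algebraMap ℚ finAdeleQ) γ * auxResFinV F (RingHom.id F) Jstar p *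
          (Matrix.GeneralLinearGroup.map (algebraMap ℚ finAdeleQ) γ)⁻¹ : GL (Fin 2 × Fin (Module.finrank ℚ F)) finAdeleQ) :
            Matrix (Fin 2 × Fin (Module.finrank ℚ F)) (Fin 2 × Fin (Module.finrank ℚ F)) finAdeleQ) i i' ∈ integralFiniteAdeles ℚ) ∧
      (∀ i i', ((Matrix.GeneralLinearGroup.map (algebraMap ℚ finAdeleQ) γ * (auxResFinV F (RingHom.id F) Jstar p)⁻¹ *
          (Matrix.GeneralLinearGroup.map (algebraMap ℚ finAdeleQ) γ)⁻¹ : GL (Fin 2 × Fin (Module.finrank ℚ F)) finAdeleQ) :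
            Matrix (Fin 2 × Fin (Module.finrank ℚ F)) (Fin 2 × Fin (Module.finrank ℚ F)) finAdeleQ) i i' ∈ integralFiniteAdeles ℚ))
    (hJ : (Jstar.map (IsCMField.complexConj F))ᵀ = Jstar)
    {w : HeightOneSpectrum (𝓞 F)} (hw : (IsCMField.complexConj F) • w ≠ w) (hJw : IsUnit (placeForm Jstar w))
    (hJi : hJw.unit ∈ glInt 2 (w.adicCompletion F))
    (hKv : IsHyperspecialAt (↥(maximalRealSubfield F)) F (IsCMField.complexConj F) 2 Jstar K (w.under (𝓞 ↥(maximalRealSubfield F))))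
    (a' : ↥(finAdelic (↥(maximalRealSubfield F)) F (IsCMField.complexConj F) 2 Jstar)) {N : ℕ}
    (r₁ : ↥(gspFinAdelic δ)) (q₁ : ↥(gspRational δ))
    (hq₁ : gspRationalToFinAdelic δ q₁ • ((r₁ : ↥(gspFinAdelic δ)) : ↥(gspFinAdelic δ) ⧸ principalLevelSubgroup δ N) =
      ((auxToGspFinV Fr (a', 1) : ↥(gspFinAdelic δ)) : ↥(gspFinAdelic δ) ⧸ principalLevelSubgroup δ N))
    (M₁ : 𝓞 F →+* Matrix (Fin g ⊕ Fin g) (Fin g ⊕ Fin g) ℤ)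
    (hM₁ : ∀ b : 𝓞 F, (M₁ b).map (Int.cast : ℤ → ℚ) =
      (((q₁⁻¹ : ↥(gspRational δ)) : GL (Fin g ⊕ Fin g) ℚ) : Matrix (Fin g ⊕ Fin g) (Fin g ⊕ Fin g) ℚ) * (ρ b).map (Int.cast : ℤ → ℚ) *
        (((q₁ : ↥(gspRational δ)) : GL (Fin g ⊕ Fin g) ℚ) : Matrix (Fin g ⊕ Fin g) (Fin g ⊕ Fin g) ℚ))
    (rc : ↥(orbit K (((heckeElementAt (↥(maximalRealSubfield F)) F (IsCMField.complexConj F) 2 Jstar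
        (⟨w, rfl⟩ : PlacesOver F (w.under (𝓞 ↥(maximalRealSubfield F)))) (IsCMField.complexConj_ne_one F) hJ hw hJw (HeckeCharacter.uniformizer F w) 1 :
          ↥(finAdelic (↥(maximalRealSubfield F)) F (IsCMField.complexConj F) 2 Jstar)) : ↥(finAdelic (↥(maximalRealSubfield F)) F (IsCMField.complexConj F) 2 Jstar) ⧸ K))) →
      ↥(finAdelic (↥(maximalRealSubfield F)) F (IsCMField.complexConj F) 2 Jstar))
    (hrc : ∀ β, ((rc β : ↥(finAdelic (↥(maximalRealSubfield F)) F (IsCMField.complexConj F) 2 Jstar)) :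
      ↥(finAdelic (↥(maximalRealSubfield F)) F (IsCMField.complexConj F) 2 Jstar) ⧸ K) = β.1) :
    ∃ Hfam : ↥(orbit K (((heckeElementAt (↥(maximalRealSubfield F)) F (IsCMField.complexConj F) 2 Jstar
        (⟨w, rfl⟩ : PlacesOver F (w.under (𝓞 ↥(maximalRealSubfield F)))) (IsCMField.complexConj_ne_one F) hJ hw hJw (HeckeCharacter.uniformizer F w) 1 :
          ↥(finAdelic (↥(maximalRealSubfield F)) F (IsCMField.complexConj F) 2 Jstar)) : ↥(finAdelic (↥(maximalRealSubfield F)) F (IsCMField.complexConj F) 2 Jstar) ⧸ K))) →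
      Submodule ℤ (Fin g ⊕ Fin g → ℚ),
      -- `hΛ`
      (∀ β, latticeOfGL ((r₁ : ↥(gspFinAdelic δ)) : GL (Fin g ⊕ Fin g) finAdeleQ) ≤ Hfam β) ∧
      -- `h𝔞`
      (∀ β, ∀ v ∈ Hfam β, ∀ b ∈ ((IsCMField.complexConj F) • w).asIdeal,
        (M₁ b).map (Int.cast : ℤ → ℚ) *ᵥ v ∈ latticeOfGL ((r₁ : ↥(gspFinAdelic δ)) : GL (Fin g ⊕ Fin g) finAdeleQ)) ∧
      -- `hinj`
      Function.Injective Hfam ∧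
      -- `hcard`
      (∀ β, (latticeOfGL ((r₁ : ↥(gspFinAdelic δ)) : GL (Fin g ⊕ Fin g) finAdeleQ)).toAddSubgroup.relIndex (Hfam β).toAddSubgroup =
        Nat.card (𝓞 F ⧸ ((IsCMField.complexConj F) • w).asIdeal)) ∧
      -- `hst`
      (∀ β (b : 𝓞 F), ∀ v ∈ Hfam β, (M₁ b).map (Int.cast : ℤ → ℚ) *ᵥ v ∈ Hfam β) ∧
      -- `hexh`
      (∀ L : Submodule ℤ (Fin g ⊕ Fin g → ℚ), latticeOfGL ((r₁ : ↥(gspFinAdelic δ)) : GL (Fin g ⊕ Fin g) finAdeleQ) ≤ L →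
        (∀ v ∈ L, ∀ b ∈ ((IsCMField.complexConj F) • w).asIdeal,
          (M₁ b).map (Int.cast : ℤ → ℚ) *ᵥ v ∈ latticeOfGL ((r₁ : ↥(gspFinAdelic δ)) : GL (Fin g ⊕ Fin g) finAdeleQ)) →
        (latticeOfGL ((r₁ : ↥(gspFinAdelic δ)) : GL (Fin g ⊕ Fin g) finAdeleQ)).toAddSubgroup.relIndex L.toAddSubgroup =
          Nat.card (𝓞 F ⧸ ((IsCMField.complexConj F) • w).asIdeal) →
        (∀ b : 𝓞 F, ∀ v ∈ L, (M₁ b).map (Int.cast : ℤ → ℚ) *ᵥ v ∈ L) → ∃ β, Hfam β = L) ∧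
      -- THE READER at a reading `(r₂, q₂)` of the translate `ũ(a′·rc β, 1)`
      (∀ β (r₂ : ↥(gspFinAdelic δ)) (q₂ : ↥(gspRational δ)),
        gspRationalToFinAdelic δ q₂ • ((r₂ : ↥(gspFinAdelic δ)) : ↥(gspFinAdelic δ) ⧸ principalLevelSubgroup δ N) =
          ((auxToGspFinV Fr (a' * rc β, 1) : ↥(gspFinAdelic δ)) : ↥(gspFinAdelic δ) ⧸ principalLevelSubgroup δ N) →
        ∀ v : Fin g ⊕ Fin g → ℚ, v ∈ Hfam β ↔
          (∀ π ∈ w.asIdeal, ((((q₂⁻¹ * q₁ : ↥(gspRational δ)) : GL (Fin g ⊕ Fin g) ℚ) : Matrix (Fin g ⊕ Fin g) (Fin g ⊕ Fin g) ℚ) *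
              (M₁ π).map (Int.cast : ℤ → ℚ)) *ᵥ v ∈ latticeOfGL ((r₂ : ↥(gspFinAdelic δ)) : GL (Fin g ⊕ Fin g) finAdeleQ)) ∧
          (∀ a ∈ ((IsCMField.complexConj F) • w).asIdeal,
              (M₁ a).map (Int.cast : ℤ → ℚ) *ᵥ v ∈ latticeOfGL ((r₁ : ↥(gspFinAdelic δ)) : GL (Fin g ⊕ Fin g) finAdeleQ))) := by
  classical
  -- §A bookkeeping: `c⁻¹ = c`, the place idempotent at `w̄ = c⁻¹ • w`, the uniformizer, the split data at `w̄`
  have hcc : (IsCMField.complexConj F)⁻¹ = IsCMField.complexConj F :=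
    algEquiv_inv_eq_self (↥(maximalRealSubfield F)) (IsCMField.complexConj_ne_one F)
  obtain ⟨ε, hε₁, hε₀⟩ := exists_placeIdempotent (F := F) ((IsCMField.complexConj F)⁻¹ • w)
  have hϖ : Valued.v ((HeckeCharacter.uniformizer F w : (w.adicCompletion F)ˣ) : w.adicCompletion F) = WithZero.exp (-1 : ℤ) :=
    HeckeCharacter.valued_uniformizer w
  obtain ⟨hu, ⟨hJu, hJui⟩, hKu⟩ := splitHyperspecialData_inv_smul K hJ hw hJw hJi hKv
  have ht : ∀ β, ((rc β : ↥(finAdelic (↥(maximalRealSubfield F)) F (IsCMField.complexConj F) 2 Jstar)) : ↥(finAdelic (↥(maximalRealSubfield F)) F (IsCMField.complexConj F) 2 Jstar) ⧸ K) ∈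
      orbit K (((heckeElementAt (↥(maximalRealSubfield F)) F (IsCMField.complexConj F) 2 Jstar (⟨w, rfl⟩ : PlacesOver F (w.under (𝓞 ↥(maximalRealSubfield F)))) (IsCMField.complexConj_ne_one F) hJ hw hJw (HeckeCharacter.uniformizer F w) 1) : ↥(finAdelic (↥(maximalRealSubfield F)) F (IsCMField.complexConj F) 2 Jstar)) : ↥(finAdelic (↥(maximalRealSubfield F)) F (IsCMField.complexConj F) 2 Jstar) ⧸ K) :=
    fun β => by rw [hrc β]; exact β.2
  -- §B the mover `q₁` as a `ℚ`-linear automorphism; `Λ(r) = q⁻¹Λ_{ũ}` readers; `q₁ · M₁ = ρ · q₁`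
  let fQ : (Fin g ⊕ Fin g → ℚ) →ₗ[ℤ] (Fin g ⊕ Fin g → ℚ) :=
    ((((q₁ : ↥(gspRational δ)) : GL (Fin g ⊕ Fin g) ℚ) : Matrix (Fin g ⊕ Fin g) (Fin g ⊕ Fin g) ℚ).mulVecLin).restrictScalars ℤ
  have hfQ : ∀ v, fQ v = (((q₁ : ↥(gspRational δ)) : GL (Fin g ⊕ Fin g) ℚ) : Matrix (Fin g ⊕ Fin g) (Fin g ⊕ Fin g) ℚ) *ᵥ v := fun _ => rfl
  have hfQs : Function.Surjective fQ := mulVecLin_surjective_of_GL ((q₁ : ↥(gspRational δ)) : GL (Fin g ⊕ Fin g) ℚ)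
  have hfQi : Function.Injective fQ := mulVecLin_injective_of_GL ((q₁ : ↥(gspRational δ)) : GL (Fin g ⊕ Fin g) ℚ)
  have hΛr : ∀ (r : ↥(gspFinAdelic δ)) (q : ↥(gspRational δ)) (x : ↥(finAdelic (↥(maximalRealSubfield F)) F (IsCMField.complexConj F) 2 Jstar)),
      gspRationalToFinAdelic δ q • ((r : ↥(gspFinAdelic δ)) : ↥(gspFinAdelic δ) ⧸ principalLevelSubgroup δ N) =
        ((auxToGspFinV Fr (x, 1) : ↥(gspFinAdelic δ)) : ↥(gspFinAdelic δ) ⧸ principalLevelSubgroup δ N) →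
      ∀ v, v ∈ latticeOfGL ((r : ↥(gspFinAdelic δ)) : GL (Fin g ⊕ Fin g) finAdeleQ) ↔
        (((q : ↥(gspRational δ)) : GL (Fin g ⊕ Fin g) ℚ) : Matrix (Fin g ⊕ Fin g) (Fin g ⊕ Fin g) ℚ) *ᵥ v ∈
          latticeOfGL ((auxToGspFinV Fr (x, 1) : ↥(gspFinAdelic δ)) : GL (Fin g ⊕ Fin g) finAdeleQ) := fun r q x hq v => by
    rw [latticeOfGL_eq_of_smul_mk_eq N r _ q hq, mem_latticeOfGL_inv_mul_iff]
  have hQinv : (((q₁ : ↥(gspRational δ)) : GL (Fin g ⊕ Fin g) ℚ) : Matrix (Fin g ⊕ Fin g) (Fin g ⊕ Fin g) ℚ) *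
      (((q₁⁻¹ : ↥(gspRational δ)) : GL (Fin g ⊕ Fin g) ℚ) : Matrix (Fin g ⊕ Fin g) (Fin g ⊕ Fin g) ℚ) = 1 := by
    rw [Subgroup.coe_inv, ← Units.val_mul, mul_inv_cancel, Units.val_one]
  have hQM : ∀ b : 𝓞 F, (((q₁ : ↥(gspRational δ)) : GL (Fin g ⊕ Fin g) ℚ) : Matrix (Fin g ⊕ Fin g) (Fin g ⊕ Fin g) ℚ) * (M₁ b).map (Int.cast : ℤ → ℚ) =
      (ρ b).map (Int.cast : ℤ → ℚ) * (((q₁ : ↥(gspRational δ)) : GL (Fin g ⊕ Fin g) ℚ) : Matrix (Fin g ⊕ Fin g) (Fin g ⊕ Fin g) ℚ) := fun b => by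
    rw [hM₁ b, ← Matrix.mul_assoc, ← Matrix.mul_assoc, hQinv, Matrix.one_mul]
  have hQMv : ∀ (b : 𝓞 F) (v : Fin g ⊕ Fin g → ℚ),
      (((q₁ : ↥(gspRational δ)) : GL (Fin g ⊕ Fin g) ℚ) : Matrix (Fin g ⊕ Fin g) (Fin g ⊕ Fin g) ℚ) *ᵥ ((M₁ b).map (Int.cast : ℤ → ℚ) *ᵥ v) =
        (ρ b).map (Int.cast : ℤ → ℚ) *ᵥ ((((q₁ : ↥(gspRational δ)) : GL (Fin g ⊕ Fin g) ℚ) : Matrix (Fin g ⊕ Fin g) (Fin g ⊕ Fin g) ℚ) *ᵥ v) := fun b v => by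
    rw [Matrix.mulVec_mulVec, Matrix.mulVec_mulVec, hQM]
  -- §C THE FRAME FAMILY `Hf β = 𝔭_w⁻¹Λ_{ũ(a′·rc β,1)} ⊓ 𝔭_{c⁻¹w}⁻¹Λ_{ũ(a′,1)}`
  let Hf : ↥(orbit K (((heckeElementAt (↥(maximalRealSubfield F)) F (IsCMField.complexConj F) 2 Jstar (⟨w, rfl⟩ : PlacesOver F (w.under (𝓞 ↥(maximalRealSubfield F)))) (IsCMField.complexConj_ne_one F) hJ hw hJw (HeckeCharacter.uniformizer F w) 1) : ↥(finAdelic (↥(maximalRealSubfield F)) F (IsCMField.complexConj F) 2 Jstar)) : ↥(finAdelic (↥(maximalRealSubfield F)) F (IsCMField.complexConj F) 2 Jstar) ⧸ K)) →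
      Submodule ℤ (Fin g ⊕ Fin g → ℚ) := fun β =>
    (⨅ π ∈ w.asIdeal, (latticeOfGL ((auxToGspFinV Fr (a' * rc β, 1) : ↥(gspFinAdelic δ)) : GL (Fin g ⊕ Fin g) finAdeleQ)).comap
      ((((ρ π).map (Int.cast : ℤ → ℚ)).mulVecLin).restrictScalars ℤ)) ⊓
    (⨅ π ∈ ((IsCMField.complexConj F)⁻¹ • w).asIdeal, (latticeOfGL ((auxToGspFinV Fr (a', 1) : ↥(gspFinAdelic δ)) : GL (Fin g ⊕ Fin g) finAdeleQ)).comap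
      ((((ρ π).map (Int.cast : ℤ → ℚ)).mulVecLin).restrictScalars ℤ))
  have hHf : ∀ β (v : Fin g ⊕ Fin g → ℚ), v ∈ Hf β ↔
      (∀ π ∈ w.asIdeal, (ρ π).map (Int.cast : ℤ → ℚ) *ᵥ v ∈ latticeOfGL ((auxToGspFinV Fr (a' * rc β, 1) : ↥(gspFinAdelic δ)) : GL (Fin g ⊕ Fin g) finAdeleQ)) ∧
      ∀ π ∈ ((IsCMField.complexConj F)⁻¹ • w).asIdeal, (ρ π).map (Int.cast : ℤ → ℚ) *ᵥ v ∈ latticeOfGL ((auxToGspFinV Fr (a', 1) : ↥(gspFinAdelic δ)) : GL (Fin g ⊕ Fin g) finAdeleQ) :=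
    fun β v => by
      change v ∈ (⨅ π ∈ w.asIdeal, _) ⊓ (⨅ π ∈ ((IsCMField.complexConj F)⁻¹ • w).asIdeal, _) ↔ _
      simp only [Submodule.mem_inf, Submodule.mem_iInf, Submodule.mem_comap, LinearMap.restrictScalars_apply, Matrix.mulVecLin_apply]
  -- the five frame facts (★ (L-c) organs)
  have hΛf : ∀ β, latticeOfGL ((auxToGspFinV Fr (a', 1) : ↥(gspFinAdelic δ)) : GL (Fin g ⊕ Fin g) finAdeleQ) ≤ Hf β := fun β =>
    latticeOfGL_auxToGspFinV_le_heckeNeighbour Fr γ T T' hTT' hT'T hP hγS ρ hρ K hγ hJ hw hJw hJi hKv _ hϖ ε hε₁ hε₀ a' (rc β) (ht β) (Hf β) (hHf β)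
  have hstf : ∀ β (b : 𝓞 F), ∀ v ∈ Hf β, (ρ b).map (Int.cast : ℤ → ℚ) *ᵥ v ∈ Hf β := fun β b v hv =>
    heckeNeighbour_auxToGspFinV_mulVec_mem Fr γ T T' hT'T hP hγS ρ hρ a' (rc β) (Hf β) (hHf β) b hv
  have hcardf : ∀ β, (latticeOfGL ((auxToGspFinV Fr (a', 1) : ↥(gspFinAdelic δ)) : GL (Fin g ⊕ Fin g) finAdeleQ)).toAddSubgroup.relIndex (Hf β).toAddSubgroup =
      Nat.card (𝓞 F ⧸ ((IsCMField.complexConj F)⁻¹ • w).asIdeal) := fun β =>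
    relIndex_latticeOfGL_auxToGspFinV_heckeNeighbour_eq Fr γ T T' hTT' hT'T hP hγS ρ hρ K hγ hJ hw hJw hJi hKv _ hϖ ε hε₁ hε₀ a' (rc β) (ht β) (Hf β) (hHf β)
  have hinjf : Function.Injective Hf := fun β β' hββ' => by
    have h := mk_eq_mk_of_heckeNeighbour_auxToGspFinV_eq Fr γ T T' hTT' hT'T hP hγS ρ hρ K hγ hJ hw hJw hJi hKv _ hϖ ε hε₁ hε₀ a' (rc β) (rc β') (ht β) (ht β')
      (Hf β) (hHf β) (Hf β') (hHf β') hββ'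
    rw [hrc β, hrc β'] at h
    exact Subtype.ext h
  have hβ : Nat.card ↥(orbit K (((heckeElementAt (↥(maximalRealSubfield F)) F (IsCMField.complexConj F) 2 Jstar (⟨w, rfl⟩ : PlacesOver F (w.under (𝓞 ↥(maximalRealSubfield F)))) (IsCMField.complexConj_ne_one F) hJ hw hJw (HeckeCharacter.uniformizer F w) 1) : ↥(finAdelic (↥(maximalRealSubfield F)) F (IsCMField.complexConj F) 2 Jstar)) : ↥(finAdelic (↥(maximalRealSubfield F)) F (IsCMField.complexConj F) 2 Jstar) ⧸ K)) =
      Nat.card (𝓞 F ⧸ ((IsCMField.complexConj F)⁻¹ • w).asIdeal) + 1 := by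
    rw [natCard_orbit_heckeElementAt_one_uniformizer hKv (⟨w, rfl⟩ : PlacesOver F (w.under (𝓞 ↥(maximalRealSubfield F)))) (IsCMField.complexConj_ne_one F) hJ hw hJw hJi,
      Ideal.absNorm_apply, Submodule.cardQuot_apply, HeightOneSpectrum.card_quotient_smul]
  -- §D THE READING FAMILY `H_β := q₁⁻¹ · Hf β`
  refine ⟨fun β => (Hf β).comap fQ, fun β => ?_, fun β v hv b hb => ?_, fun β β' hββ' => hinjf (Submodule.comap_injective_of_surjective hfQs hββ'),
    fun β => ?_, fun β b v hv => ?_, fun L hL hL𝔞 hLcard hLst => ?_, fun β r₂ q₂ hq₂ v => ?_⟩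
  · -- `hΛ`
    intro v hv
    rw [Submodule.mem_comap, hfQ]
    exact hΛf β ((hΛr r₁ q₁ a' hq₁ v).1 hv)
  · -- `h𝔞`
    rw [hΛr r₁ q₁ a' hq₁, hQMv]
    rw [Submodule.mem_comap, hfQ] at hv
    rw [← hcc] at hb
    exact ((hHf β _).1 hv).2 b hb
  · -- `hcard`
    have e : latticeOfGL ((r₁ : ↥(gspFinAdelic δ)) : GL (Fin g ⊕ Fin g) finAdeleQ) =
        (latticeOfGL ((auxToGspFinV Fr (a', 1) : ↥(gspFinAdelic δ)) : GL (Fin g ⊕ Fin g) finAdeleQ)).comap fQ :=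
      Submodule.ext fun v => by rw [Submodule.mem_comap, hfQ]; exact hΛr r₁ q₁ a' hq₁ v
    rw [e, relIndex_comap_comap_of_surjective fQ hfQs, hcardf β, hcc]
  · -- `hst`
    rw [Submodule.mem_comap, hfQ] at hv ⊢
    rw [hQMv]
    exact hstf β b _ hv
  · -- `hexh`: move `L` to the frame by `q₁`
    have e : latticeOfGL ((r₁ : ↥(gspFinAdelic δ)) : GL (Fin g ⊕ Fin g) finAdeleQ) =
        (latticeOfGL ((auxToGspFinV Fr (a', 1) : ↥(gspFinAdelic δ)) : GL (Fin g ⊕ Fin g) finAdeleQ)).comap fQ :=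
      Submodule.ext fun v => by rw [Submodule.mem_comap, hfQ]; exact hΛr r₁ q₁ a' hq₁ v
    have hLf : (L.map fQ).comap fQ = L := Submodule.comap_map_eq_of_injective hfQi L
    have h1 : latticeOfGL ((auxToGspFinV Fr (a', 1) : ↥(gspFinAdelic δ)) : GL (Fin g ⊕ Fin g) finAdeleQ) ≤ L.map fQ := by
      intro u hu
      obtain ⟨v, rfl⟩ := hfQs u
      have hv : v ∈ latticeOfGL ((r₁ : ↥(gspFinAdelic δ)) : GL (Fin g ⊕ Fin g) finAdeleQ) := by rw [e, Submodule.mem_comap]; exact hu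
      exact Submodule.mem_map_of_mem (hL hv)
    have h2 : ∀ u ∈ L.map fQ, ∀ π ∈ ((IsCMField.complexConj F)⁻¹ • w).asIdeal,
        (ρ π).map (Int.cast : ℤ → ℚ) *ᵥ u ∈ latticeOfGL ((auxToGspFinV Fr (a', 1) : ↥(gspFinAdelic δ)) : GL (Fin g ⊕ Fin g) finAdeleQ) := by
      intro u hu π hπ
      obtain ⟨v, hv, rfl⟩ := Submodule.mem_map.1 hu
      rw [hfQ, ← hQMv, ← hΛr r₁ q₁ a' hq₁]
      rw [hcc] at hπ
      exact hL𝔞 v hv π hπ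
    have h3 : (latticeOfGL ((auxToGspFinV Fr (a', 1) : ↥(gspFinAdelic δ)) : GL (Fin g ⊕ Fin g) finAdeleQ)).toAddSubgroup.relIndex (L.map fQ).toAddSubgroup =
        Nat.card (𝓞 F ⧸ ((IsCMField.complexConj F)⁻¹ • w).asIdeal) := by
      rw [← relIndex_comap_comap_of_surjective fQ hfQs, ← e, hLf, hLcard, hcc]
    have h4 : ∀ (b : 𝓞 F), ∀ u ∈ L.map fQ, (ρ b).map (Int.cast : ℤ → ℚ) *ᵥ u ∈ L.map fQ := by
      intro b u hu
      obtain ⟨v, hv, rfl⟩ := Submodule.mem_map.1 hu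
      rw [hfQ, ← hQMv]
      exact Submodule.mem_map_of_mem (hLst b v hv)
    obtain ⟨β, hβL⟩ := exists_eq_of_injective_heckeNeighbour_auxToGspFinV Fr γ T T' hTT' hT'T hP hγS ρ hρ K hγ hJ hu hJu hJui hKu ε hε₁ hε₀ a' hβ
      Hf hinjf hΛf (fun β v hv => ((hHf β v).1 hv).2) hcardf hstf (L.map fQ) h1 h2 h3 h4
    refine ⟨β, ?_⟩
    change (Hf β).comap fQ = L
    rw [hβL, hLf]
  · -- THE READER at `(r₂, q₂)`
    rw [Submodule.mem_comap, hfQ, hHf, hcc]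
    refine and_congr (forall₂_congr fun π _ => ?_) (forall₂_congr fun a _ => ?_)
    · have hT : (((q₂ : ↥(gspRational δ)) : GL (Fin g ⊕ Fin g) ℚ) : Matrix (Fin g ⊕ Fin g) (Fin g ⊕ Fin g) ℚ) *
          (((q₂⁻¹ * q₁ : ↥(gspRational δ)) : GL (Fin g ⊕ Fin g) ℚ) : Matrix (Fin g ⊕ Fin g) (Fin g ⊕ Fin g) ℚ) =
          (((q₁ : ↥(gspRational δ)) : GL (Fin g ⊕ Fin g) ℚ) : Matrix (Fin g ⊕ Fin g) (Fin g ⊕ Fin g) ℚ) := by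
        rw [Subgroup.coe_mul, Subgroup.coe_inv, Units.val_mul, ← Matrix.mul_assoc, ← Units.val_mul, mul_inv_cancel, Units.val_one, Matrix.one_mul]
      rw [hΛr r₂ q₂ (a' * rc β) hq₂, Matrix.mulVec_mulVec, Matrix.mulVec_mulVec, ← Matrix.mul_assoc, hT, hQM]
    · rw [hΛr r₁ q₁ a' hq₁, hQMv]

end AuxV

end UnitaryCurve

end Literature.AlgebraicGeometry.ShimuraVarieties

end
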